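import Literature.AnabelianGeometry.SemiGraphs.PSCSeparatingCoveringsThreeChain
import Literature.AnabelianGeometry.SemiGraphs.PSCSeparatingCoveringsThreeChainEdges
import Literature.AnabelianGeometry.SemiGraphs.PSCUnrVerticialSeparatingCoveringsThreeChain
import Literature.AnabelianGeometry.SemiGraphs.PSCThreeChainOrigin
import HarnessLib

/-!
# [CombGC] Prop. 1.2, proof p. 9: rows F-2829 / F-2830 and ALL of Prop. 1.2 (i)(ii) at the THREE-COMPONENT CHAIN

Mochizuki, *A combinatorial version of the Grothendieck conjecture*, Tohoku Math. J. **59** (2007)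
[CombGC], PROOF of Proposition 1.2, p. 9 (separating coverings) [cite: MochizukiCombGC2007, Prop 1.2 proof p.9]
and Prop. 1.2 (i)(ii) p. 8 [cite: MochizukiCombGC2007, Prop 1.2 pp.8-9]; abc-iut FACT-LIST rows F-2829
`PSCDatum.SeparatingCoverings` (= verticial ∧ edge-like ∧ `Π^unr`-verticial separating coverings, sub-DAG
row P12-L01 of abc-iut-w4-d081's `PSCSeparatingCoverings.lean`), F-2830 `SeparatingCoveringsHolds Ω`, F-0459
`OpenInterDeterminesComponentHolds`, F-0438 `CommensurableTerminalityHolds` (universal closures refuted,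
instance forms at genuine carriers are the content).

PROOF-ONLY assembly file (abc-iut-f-164 gen 4): at the THREE-COMPONENT CHAIN data of gen 3
(`PSCThreeChainShape.lean`: `C₀ ∪_{ν_A} C_mid ∪_{ν_B} C₁`, TWO nodes, THREE vertices, any genera) the three
conjuncts hold by `PSCSeparatingCoveringsThreeChain` (verticial: ONE chain basis, fibred twist / projection),
`PSCSeparatingCoveringsThreeChainEdges` (edge-like: cusp characters) and
`PSCUnrVerticialSeparatingCoveringsThreeChain` (`Π^unr`: the chain Tietze isomorphism
`Γ/⟨⟨c_j, ε_A, η⟩⟩ ≅ Γ_{g₀,0} ∗ (Γ_{g₁−g₀,0} ∗ Γ_{g−g₁,0})`).  Hence: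

* `separatingCoverings_of_threeChain` — **row F-2829 at every three-component chain datum** (the first
  instance at TWO-NODE data); `prop12_of_threeChain` — ALL five typed clauses of Prop. 1.2 (i)(ii) there in
  one stroke by abc-iut-w5-d183's `prop12_of_separating` (gen 3 had them one by one except the sturdy
  `Π^unr`-clause of (ii), closed in `PSCUnrVerticialSeparatingCoveringsThreeChain`);
* `exists_threeChain_separatingCoverings_sturdy` — non-vacuity at STURDY two-node data: the chain with genera
  `(2,2,2)` over `Γ_{6,6}` is sturdy and satisfies F-2829;
* `exists_threeChainOrigin_separatingCoveringsHolds_all` — **row F-2830 at the inhabited origin of ALL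
  three-component chain data** (together with F-0438 and F-0459 there).

A shape instance is consistency evidence for the typed schemata, not the printed statement for all pointed
stable curves (cell FOUNDATIONS rows 13–14).  0 definitions; nothing here takes a side on [IUTchIII] Cor. 3.12.
-/

noncomputable section

namespace Literature.AnabelianGeometry.SemiGraphs

namespace PSCDatum

open scoped Pointwise
open Literature.GroupTheory.CombinatorialGroupTheory
open Literature.GroupTheory.CombinatorialGroupTheory.PuncturedSurfaceGroup (cuspInertia)
open SemiGraphOfAnabelioids (IsProSigmaCompletion)

section ThreeChain

variable {P : Type} [Group P] [TopologicalSpace P] [IsTopologicalGroup P]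
variable [CompactSpace P] [T2Space P] [TotallyDisconnectedSpace P] {Sigma : Set ℕ} {g r : ℕ}

/-- **Row F-2829 `SeparatingCoverings` at EVERY genuine three-component chain datum** (two nodes, three
vertices, genera `g₀`, `g₁ − g₀`, `g − g₁` arbitrary; `2 ≤ s₁`, `s₁ + 2 ≤ s₂`, `s₂ + 2 ≤ r`): verticial
conjunct by free factors of one chain basis, edge-like conjunct by cusp characters and rank-one free factors,
`Π^unr` conjunct by the chain Tietze isomorphism and the fibred twist. [cite: MochizukiCombGC2007, Prop 1.2 proof p.9] -/
theorem separatingCoverings_of_threeChain (hne : Sigma.Nonempty)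
    (hprime : ∀ p ∈ Sigma, p.Prime) (ι : PuncturedSurfaceGroup g r →* P)
    (hι : IsProSigmaCompletion Sigma ι) (G : PSCDatum P) {g₀ g₁ s₁ s₂ : ℕ} (hg : g₀ ≤ g₁) (hg₁ : g₁ ≤ g)
    (hs₁ : 2 ≤ s₁) (hs₁₂ : s₁ + 2 ≤ s₂) (hs₂ : s₂ + 2 ≤ r) (e : G.graph.C ≃ Fin r)
    (hC : ∀ c', G.cuspGp c' = ((cuspInertia (g := g) (e c')).map ι).topologicalClosure)
    (v₀ vm v₁ : G.graph.V) (hV : ∀ w, w = v₀ ∨ w = vm ∨ w = v₁) (εA η : PuncturedSurfaceGroup g r)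
    (hεA : εA = ((List.finRange r).map fun j : Fin r =>
          if s₂ ≤ (j : ℕ) then PuncturedSurfaceGroup.c (g := g) j else 1).prod *
        ((List.finRange g).map fun i : Fin g => if (i : ℕ) < g₀ then
          PuncturedSurfaceGroup.a (r := r) i * PuncturedSurfaceGroup.b i *
            (PuncturedSurfaceGroup.a i)⁻¹ * (PuncturedSurfaceGroup.b i)⁻¹ else 1).prod)
    (hη : η = ((List.finRange r).map fun j : Fin r =>
          if s₁ ≤ (j : ℕ) then PuncturedSurfaceGroup.c (g := g) j else 1).prod *
        ((List.finRange g).map fun i : Fin g => if (i : ℕ) < g₁ then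
          PuncturedSurfaceGroup.a (r := r) i * PuncturedSurfaceGroup.b i *
            (PuncturedSurfaceGroup.a i)⁻¹ * (PuncturedSurfaceGroup.b i)⁻¹ else 1).prod)
    (hV₀ : G.vertGp v₀ = ((Subgroup.closure {x : PuncturedSurfaceGroup g r |
        (∃ i : Fin g, (i : ℕ) < g₀ ∧ (x = PuncturedSurfaceGroup.a i ∨ x = PuncturedSurfaceGroup.b i)) ∨
        ∃ j : Fin r, s₂ ≤ (j : ℕ) ∧ x = PuncturedSurfaceGroup.c j}).map ι).topologicalClosure)
    (hVm : G.vertGp vm = ((Subgroup.closure {x : PuncturedSurfaceGroup g r |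
        (∃ i : Fin g, (g₀ ≤ (i : ℕ) ∧ (i : ℕ) < g₁) ∧
          (x = PuncturedSurfaceGroup.a i ∨ x = PuncturedSurfaceGroup.b i)) ∨
        (∃ j : Fin r, (s₁ ≤ (j : ℕ) ∧ (j : ℕ) < s₂) ∧ x = PuncturedSurfaceGroup.c j) ∨
        x = εA ∨ x = η}).map ι).topologicalClosure)
    (hV₁ : G.vertGp v₁ = ((Subgroup.closure {x : PuncturedSurfaceGroup g r |
        (∃ i : Fin g, g₁ ≤ (i : ℕ) ∧ (x = PuncturedSurfaceGroup.a i ∨ x = PuncturedSurfaceGroup.b i)) ∨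
        (∃ j : Fin r, (j : ℕ) < s₁ ∧ x = PuncturedSurfaceGroup.c j) ∨ x = η}).map ι).topologicalClosure)
    (nA nB : G.graph.N) (hN : ∀ n, n = nA ∨ n = nB)
    (hEA : G.nodeGp nA = ((Subgroup.zpowers εA).map ι).topologicalClosure)
    (hEB : G.nodeGp nB = ((Subgroup.zpowers η).map ι).topologicalClosure)
    (hgen₀ : G.genus v₀ = g₀) (hgenm : G.genus vm = g₁ - g₀) (hgen₁ : G.genus v₁ = g - g₁) :
    G.SeparatingCoverings :=
  ⟨G.verticialSeparatingCoverings_of_threeChain hne hprime ι hι hg hs₁ hs₁₂ hs₂ e hC v₀ vm v₁ hV εA η hεA hη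
      hV₀ hVm hV₁ nA nB hN hEA hEB,
    G.edgeLikeSeparatingCoverings_of_threeChain hne hprime ι hι hg hs₁ hs₁₂ hs₂ e hC v₀ vm v₁ hV εA η hεA hη
      hV₀ hVm hV₁ nA nB hN hEA hEB,
    G.unrVerticialSeparatingCoverings_of_threeChain hne hprime ι hι hg hg₁ hs₁ hs₁₂ hs₂ e hC v₀ vm v₁ hV εA η
      hεA hη hV₀ hVm hV₁ nA nB hN hEA hEB hgen₀ hgenm hgen₁⟩

/-- **[CombGC] Prop. 1.2 (i) and (ii), ALL five typed clauses, at every genuine three-component chain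
datum** (two nodes, three vertices, any genera — sturdy chains included), in one stroke from
`separatingCoverings_of_threeChain` by abc-iut-w5-d183's `prop12_of_separating`.
[cite: MochizukiCombGC2007, Prop 1.2 pp.8-9] -/
theorem prop12_of_threeChain (hne : Sigma.Nonempty)
    (hprime : ∀ p ∈ Sigma, p.Prime) (ι : PuncturedSurfaceGroup g r →* P)
    (hι : IsProSigmaCompletion Sigma ι) (G : PSCDatum P) {g₀ g₁ s₁ s₂ : ℕ} (hg : g₀ ≤ g₁) (hg₁ : g₁ ≤ g)
    (hs₁ : 2 ≤ s₁) (hs₁₂ : s₁ + 2 ≤ s₂) (hs₂ : s₂ + 2 ≤ r) (e : G.graph.C ≃ Fin r)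
    (hC : ∀ c', G.cuspGp c' = ((cuspInertia (g := g) (e c')).map ι).topologicalClosure)
    (v₀ vm v₁ : G.graph.V) (hV : ∀ w, w = v₀ ∨ w = vm ∨ w = v₁) (εA η : PuncturedSurfaceGroup g r)
    (hεA : εA = ((List.finRange r).map fun j : Fin r =>
          if s₂ ≤ (j : ℕ) then PuncturedSurfaceGroup.c (g := g) j else 1).prod *
        ((List.finRange g).map fun i : Fin g => if (i : ℕ) < g₀ then
          PuncturedSurfaceGroup.a (r := r) i * PuncturedSurfaceGroup.b i *
            (PuncturedSurfaceGroup.a i)⁻¹ * (PuncturedSurfaceGroup.b i)⁻¹ else 1).prod)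
    (hη : η = ((List.finRange r).map fun j : Fin r =>
          if s₁ ≤ (j : ℕ) then PuncturedSurfaceGroup.c (g := g) j else 1).prod *
        ((List.finRange g).map fun i : Fin g => if (i : ℕ) < g₁ then
          PuncturedSurfaceGroup.a (r := r) i * PuncturedSurfaceGroup.b i *
            (PuncturedSurfaceGroup.a i)⁻¹ * (PuncturedSurfaceGroup.b i)⁻¹ else 1).prod)
    (hV₀ : G.vertGp v₀ = ((Subgroup.closure {x : PuncturedSurfaceGroup g r |
        (∃ i : Fin g, (i : ℕ) < g₀ ∧ (x = PuncturedSurfaceGroup.a i ∨ x = PuncturedSurfaceGroup.b i)) ∨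
        ∃ j : Fin r, s₂ ≤ (j : ℕ) ∧ x = PuncturedSurfaceGroup.c j}).map ι).topologicalClosure)
    (hVm : G.vertGp vm = ((Subgroup.closure {x : PuncturedSurfaceGroup g r |
        (∃ i : Fin g, (g₀ ≤ (i : ℕ) ∧ (i : ℕ) < g₁) ∧
          (x = PuncturedSurfaceGroup.a i ∨ x = PuncturedSurfaceGroup.b i)) ∨
        (∃ j : Fin r, (s₁ ≤ (j : ℕ) ∧ (j : ℕ) < s₂) ∧ x = PuncturedSurfaceGroup.c j) ∨
        x = εA ∨ x = η}).map ι).topologicalClosure)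
    (hV₁ : G.vertGp v₁ = ((Subgroup.closure {x : PuncturedSurfaceGroup g r |
        (∃ i : Fin g, g₁ ≤ (i : ℕ) ∧ (x = PuncturedSurfaceGroup.a i ∨ x = PuncturedSurfaceGroup.b i)) ∨
        (∃ j : Fin r, (j : ℕ) < s₁ ∧ x = PuncturedSurfaceGroup.c j) ∨ x = η}).map ι).topologicalClosure)
    (nA nB : G.graph.N) (hN : ∀ n, n = nA ∨ n = nB)
    (hEA : G.nodeGp nA = ((Subgroup.zpowers εA).map ι).topologicalClosure)
    (hEB : G.nodeGp nB = ((Subgroup.zpowers η).map ι).topologicalClosure)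
    (hgen₀ : G.genus v₀ = g₀) (hgenm : G.genus vm = g₁ - g₀) (hgen₁ : G.genus v₁ = g - g₁) :
    (G.VerticialOpenInterDeterminesVertex ∧ G.EdgeLikeOpenInterDeterminesEdge ∧
      G.UnrVerticialOpenInterDeterminesVertex) ∧
    (G.VerticialEdgeLikeCommensurablyTerminal ∧ G.UnrVerticialCommensurablyTerminal) :=
  G.prop12_of_separating (G.separatingCoverings_of_threeChain hne hprime ι hι hg hg₁ hs₁ hs₁₂ hs₂ e hC v₀ vm
    v₁ hV εA η hεA hη hV₀ hVm hV₁ nA nB hN hEA hEB hgen₀ hgenm hgen₁)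

/-- **Non-vacuity of row F-2829 at STURDY TWO-NODE data**: for every nonempty set of primes `Σ` the
profinite pro-`Σ` chain datum with genera `(2,2,2)`, two nodes and six cusps over `Γ_{6,6}` (gen 3's
`exists_threeChainDatum 6 6 2 4 2 4`) is sturdy AND satisfies `SeparatingCoverings`.
[cite: MochizukiCombGC2007, Prop 1.2 proof p.9] -/
theorem exists_threeChain_separatingCoverings_sturdy (Sigma : Set ℕ) (hne : Sigma.Nonempty)
    (hprime : ∀ p ∈ Sigma, p.Prime) :
    ∃ (Q : ProfiniteGrp.{0}) (G : PSCDatum Q), G.Sigma = Sigma ∧ G.graph.i = 3 ∧ G.graph.n = 2 ∧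
      G.graph.r = 6 ∧ (∀ v, G.genus v = 2) ∧ G.IsSturdy ∧ G.SeparatingCoverings := by
  obtain ⟨Q, ι, G, e, v₀, vm, v₁, nA, nB, εA, η, hι, hS, hi, hn, hr, hC, hV, hN, hεA, hη, hV₀, hVm, hV₁,
    hEA, hEB, hgen₀, hgenm, hgen₁, -, -⟩ := exists_threeChainDatum Sigma hne hprime 6 6 2 4 2 4
  have hgen : ∀ v, G.genus v = 2 := fun v => by
    rcases hV v with rfl | rfl | rfl
    · exact hgen₀
    · exact hgenm
    · exact hgen₁
  exact ⟨Q, G, hS, hi, hn, hr, hgen, fun v => by rw [hgen v],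
    G.separatingCoverings_of_threeChain hne hprime ι hι (g₀ := 2) (g₁ := 4) (s₁ := 2) (s₂ := 4)
      (by norm_num) (by norm_num) le_rfl le_rfl le_rfl e hC v₀ vm v₁ hV εA η hεA hη hV₀ hVm hV₁ nA nB hN hEA
      hEB hgen₀ hgenm hgen₁⟩

end ThreeChain

/-! ### Row F-2830 at the origin of all three-component chain data -/

/-- **Row F-2830 `SeparatingCoveringsHolds Ω`, F-0438 `CommensurableTerminalityHolds Ω` (both clauses) and
F-0459 `OpenInterDeterminesComponentHolds Ω` at the INHABITED origin `Ω_3ch` of ALL data of three-component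
chain shape** (over profinite pro-`Σ` completions of `Γ_{g,r}` in `Type`; genus pins, no sturdiness
restriction; the origin is inhabited by the STURDY chain of genera `(2,2,2)`, two nodes, six cusps).
[cite: MochizukiCombGC2007, Prop 1.2 proof p.9] -/
theorem exists_threeChainOrigin_separatingCoveringsHolds_all (Sigma : Set ℕ) (hne : Sigma.Nonempty)
    (hprime : ∀ p ∈ Sigma, p.Prime) :
    ∃ Ω : PSCOrigin.{0},
      (∃ (Q : ProfiniteGrp.{0}) (G : PSCDatum Q), Ω.IsOfPSCType G ∧ G.IsSturdy ∧ G.Sigma = Sigma ∧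
        G.graph.i = 3 ∧ G.graph.n = 2 ∧ G.graph.r = 6) ∧
      SeparatingCoveringsHolds Ω ∧ CommensurableTerminalityHolds Ω ∧ OpenInterDeterminesComponentHolds Ω := by
  classical
  let Ω : PSCOrigin.{0} :=
    ⟨fun {Q} _ _ G => ∃ (_ : IsTopologicalGroup Q), CompactSpace Q ∧ T2Space Q ∧ TotallyDisconnectedSpace Q ∧
      ∃ (S : Set ℕ) (g r g₀ g₁ s₁ s₂ : ℕ) (ι : PuncturedSurfaceGroup g r →* Q) (e : G.graph.C ≃ Fin r)
        (v₀ vm v₁ : G.graph.V) (nA nB : G.graph.N) (εA η : PuncturedSurfaceGroup g r),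
        S.Nonempty ∧ (∀ p ∈ S, p.Prime) ∧ IsProSigmaCompletion S ι ∧ g₀ ≤ g₁ ∧ g₁ ≤ g ∧ 2 ≤ s₁ ∧
        s₁ + 2 ≤ s₂ ∧ s₂ + 2 ≤ r ∧
        (∀ c, G.cuspGp c =
          ((PuncturedSurfaceGroup.cuspInertia (g := g) (e c)).map ι).topologicalClosure) ∧
        (∀ w, w = v₀ ∨ w = vm ∨ w = v₁) ∧ (∀ n, n = nA ∨ n = nB) ∧
        εA = ((List.finRange r).map fun j : Fin r =>
            if s₂ ≤ (j : ℕ) then PuncturedSurfaceGroup.c (g := g) j else 1).prod *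
          ((List.finRange g).map fun i : Fin g => if (i : ℕ) < g₀ then
            PuncturedSurfaceGroup.a (r := r) i * PuncturedSurfaceGroup.b i *
              (PuncturedSurfaceGroup.a i)⁻¹ * (PuncturedSurfaceGroup.b i)⁻¹ else 1).prod ∧
        η = ((List.finRange r).map fun j : Fin r =>
            if s₁ ≤ (j : ℕ) then PuncturedSurfaceGroup.c (g := g) j else 1).prod *
          ((List.finRange g).map fun i : Fin g => if (i : ℕ) < g₁ then
            PuncturedSurfaceGroup.a (r := r) i * PuncturedSurfaceGroup.b i *
              (PuncturedSurfaceGroup.a i)⁻¹ * (PuncturedSurfaceGroup.b i)⁻¹ else 1).prod ∧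
        G.vertGp v₀ = ((Subgroup.closure {x : PuncturedSurfaceGroup g r |
          (∃ i : Fin g, (i : ℕ) < g₀ ∧ (x = PuncturedSurfaceGroup.a i ∨ x = PuncturedSurfaceGroup.b i)) ∨
          ∃ j : Fin r, s₂ ≤ (j : ℕ) ∧ x = PuncturedSurfaceGroup.c j}).map ι).topologicalClosure ∧
        G.vertGp vm = ((Subgroup.closure {x : PuncturedSurfaceGroup g r |
          (∃ i : Fin g, (g₀ ≤ (i : ℕ) ∧ (i : ℕ) < g₁) ∧
            (x = PuncturedSurfaceGroup.a i ∨ x = PuncturedSurfaceGroup.b i)) ∨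
          (∃ j : Fin r, (s₁ ≤ (j : ℕ) ∧ (j : ℕ) < s₂) ∧ x = PuncturedSurfaceGroup.c j) ∨
          x = εA ∨ x = η}).map ι).topologicalClosure ∧
        G.vertGp v₁ = ((Subgroup.closure {x : PuncturedSurfaceGroup g r |
          (∃ i : Fin g, g₁ ≤ (i : ℕ) ∧ (x = PuncturedSurfaceGroup.a i ∨ x = PuncturedSurfaceGroup.b i)) ∨
          (∃ j : Fin r, (j : ℕ) < s₁ ∧ x = PuncturedSurfaceGroup.c j) ∨ x = η}).map ι).topologicalClosure ∧
        G.nodeGp nA = ((Subgroup.zpowers εA).map ι).topologicalClosure ∧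
        G.nodeGp nB = ((Subgroup.zpowers η).map ι).topologicalClosure ∧
        G.genus v₀ = g₀ ∧ G.genus vm = g₁ - g₀ ∧ G.genus v₁ = g - g₁⟩
  have hsep : SeparatingCoveringsHolds Ω := by
    intro Q _ _ _ G hG
    obtain ⟨_, hc, ht, hd, S, g, r, g₀, g₁, s₁, s₂, ι, e, v₀, vm, v₁, nA, nB, εA, η, hSne, hSp, hι, hg, hg₁,
      hs₁, hs₁₂, hs₂, hC, hV, hN, hεA, hη, hV₀, hVm, hV₁, hEA, hEB, hgen₀, hgenm, hgen₁⟩ := hG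
    haveI := hc
    haveI := ht
    haveI := hd
    exact G.separatingCoverings_of_threeChain hSne hSp ι hι hg hg₁ hs₁ hs₁₂ hs₂ e hC v₀ vm v₁ hV εA η hεA hη
      hV₀ hVm hV₁ nA nB hN hEA hEB hgen₀ hgenm hgen₁
  have hprof : ∀ ⦃Q : Type⦄ [Group Q] [TopologicalSpace Q] [IsTopologicalGroup Q] (G : PSCDatum Q),
      Ω.IsOfPSCType G → CompactSpace Q ∧ TotallyDisconnectedSpace Q := fun Q _ _ _ G hG => by
    obtain ⟨_, hc, -, hd, -⟩ := hG
    exact ⟨hc, hd⟩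
  refine ⟨Ω, ?_, hsep, commensurableTerminalityHolds_of_separating Ω hsep hprof,
    openInterDeterminesComponentHolds_of_separating Ω hsep hprof⟩
  obtain ⟨Q, ι, G, e, v₀, vm, v₁, nA, nB, εA, η, hι, hS, hi, hn, hr, hC, hV, hN, hεA, hη, hV₀, hVm, hV₁,
    hEA, hEB, hgen₀, hgenm, hgen₁, -, -⟩ := exists_threeChainDatum Sigma hne hprime 6 6 2 4 2 4
  have hgen : ∀ v, G.genus v = 2 := fun v => by
    rcases hV v with rfl | rfl | rfl
    · exact hgen₀
    · exact hgenm
    · exact hgen₁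
  refine ⟨Q, G, ?_, fun v => by rw [hgen v], hS, hi, hn, hr⟩
  exact ⟨inferInstance, inferInstance, inferInstance, inferInstance, Sigma, 6, 6, 2, 4, 2, 4, ι, e, v₀, vm, v₁,
    nA, nB, εA, η, hne, hprime, hι, by norm_num, by norm_num, le_rfl, le_rfl, le_rfl, hC, hV, hN, hεA, hη,
    hV₀, hVm, hV₁, hEA, hEB, hgen₀, hgenm, hgen₁⟩

end PSCDatum

end Literature.AnabelianGeometry.SemiGraphs

end
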